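import Literature.MathematicalPhysics.QuantumLattice.HubbardWave0LiebProofs
import HarnessLib

/-!
# Lieb's two-species representation of the Hubbard Hamiltonian (hole–particle transformed)

Trunk T-QLATTICE, family `hubbard`. Infrastructure for the proof of Lieb's Theorem 2
(E. H. Lieb, *Two theorems on the Hubbard model*, Phys. Rev. Lett. **62** (1989) 1201–1204,
Erratum 1927; reprint read in A. Montorsi (ed.), *The Hubbard Model*, World Scientific, pp. 111–119
of the held copy) for the concrete Jordan–Wigner model of `HubbardWave0` (orbitals
`Orb Λ = Λ ×ₗ Fin 2` in site-major order). It continues the Theorem-1 development already in the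
tree and imports it: `HubbardWave0LiebProofs` (namespace `LiebThm1`: entries and actions of the
bilinears `c†_i c_j`, the bilinear commutator, `[H, S^±] = 0`, `H` Hermitian, `[S⁺, S⁻] = 2S^z`,
`PreservesSectors (hamiltonian G t U)`, `pairSign_insert_right`/`pairSign_mul_self`/`star_pairSign`,
reality and symmetry of `hoppingMatrix`/`liebK`, `hoppingMatrix_hop_ne_zero`, and the discharge of
`hamiltonian_isHermitian_and_commute`), hence `HubbardLiebConfig` (`upPart`, `downPart`, `pairSet`,
`pairSign`, `leSign`, `gtSign`, `leSign_mul_gtSign`, `jwSign_orb_zero/one`, `hoppingMatrix`, `Config Λ n`,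
`liebK`, `liebL`) and `FermionOperatorsProofs` (Jordan–Wigner sign rules, CAR). Nothing of that is
re-proved; new declarations live in the namespace `Literature.Hubbard.LiebTwo`.

## Contents

* Complements to the sign calculus: `memSign`, the bridge `leSign_eq_jwSign_mul_memSign` (whence
  `jwSign_mul_memSign_mul_gtSign` from `leSign_mul_gtSign`), insert/erase rules for `gtSign`,
  `jwSign_union`, `jwSign_insert`, `jwSign_pair_swap`, `jwSign_orb_one_eq`, `pairSign_eq_prod_gtSign`;
  explicit actions of `n_{xσ}`, `N`, `S^±` (sign-free on-site flips) and of the hopping terms in the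
  coordinates `pairSet α γ`.
* The second `su(2)` relation `[S^z, S⁺] = S⁺` and the **discharge of
  `FermionOperators.spin_su2_relations`** (`spin_su2_relations_holds`; the first relation is
  `LiebThm1.spinPlus_mul_spinMinus_sub`).
* Lieb's change of basis on the whole Fock space, hole–particle transformed in the **down**
  species (Lieb transforms the up species; equivalent by `↑ ↔ ↓`):
  `toFock A M (α↑ ∪ γ↓) = pairSign α γ · κ_A(γᶜ) · M α γᶜ` with the hole–particle sign
  `kappaSign A β = Π_{z∈β} ε_A(z) (-1)^{pos z}` (`ε_A = -1` on `A`; the weight of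
  `QLattice.particleHole (memSign A)`, `particleHole_memSign_apply`), its inverse `ofFock`, the
  bijection `holeConfigEquiv = configEquiv` followed by complementation of the down set, unitarity
  for the Hilbert–Schmidt product `hsInner` (`star_toFock_dotProduct_toFock`), and the **intertwining
  identity** `hamiltonian_mulVec_toFock`: `H ψ_M = ψ_{𝓛 M}`,
  `𝓛 M = liebOp K numberAt (-U) M + U N M = K M + M K - U Σ_x n_x M n_x + U N M` (`liebOperator`, built
  from the generic `Literature.MathematicalPhysics.QuantumLattice.liebOp` of `LiebSpinReflection`) with `K = hoppingMatrix G t`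
  (real symmetric, particle-number preserving) — eqs. (4)–(5) of the PRL in the occupation basis;
  bipartiteness enters only through `kappaSign_exchange`. Restricted to `n`-particle blocks,
  `K` and `n_x` are the tree's `liebK G t n`, `liebL n x` (`hoppingMatrix_submatrix`,
  `numberAt_submatrix`), which is how the sequel file on the half-filled sector (forthcoming) continues.
  (The Theorem-1 file
  transfers `H` on the untransformed `(n, n)` sector, `LiebThm1.liebW_hamiltonian_mulVec`; Theorem 2
  needs the transformed basis on the sectors `(n, |Λ| - n)`, which is what `toFock` provides.)

Everything is proved by explicit matrix-entry / `mulVec` computations in the occupation basis.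
-/

noncomputable section

namespace Literature.MathematicalPhysics.QuantumLattice.LiebTwo

open Matrix Finset LiebThm1
open scoped ComplexOrder

attribute [local simp] Literature.MathematicalPhysics.QuantumLattice.star_jwSign

section Fock

variable {ι : Type*} [LinearOrder ι]

/-! ### Jordan–Wigner signs -/

/-- The Jordan–Wigner sign is multiplicative over disjoint unions. [folklore] -/
theorem jwSign_union {s t : Finset ι} (h : Disjoint s t) (i : ι) :
    jwSign i (s ∪ t) = jwSign i s * jwSign i t := by
  unfold jwSign
  rw [filter_union, card_union_of_disjoint (disjoint_filter_filter h), pow_add]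

/-- The membership sign `(-1)^{[i ∈ s]}`. [folklore] -/
def memSign (s : Finset ι) (i : ι) : ℂ := if i ∈ s then -1 else 1

/-- `memSign s i` is a sign. [folklore] -/
theorem memSign_mul_self (s : Finset ι) (i : ι) : memSign s i * memSign s i = 1 := by
  unfold memSign; split_ifs <;> norm_num

/-- `memSign` is real. [folklore] -/
theorem star_memSign (s : Finset ι) (i : ι) : star (memSign s i) = memSign s i := by
  unfold memSign; split_ifs <;> simp

/-- Bridge to `HubbardLiebConfig`: `leSign i s = jwSign i s · (-1)^{[i ∈ s]}` (the elements of `s`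
that are `≤ i` are those `< i` together with `i` itself if present). [folklore] -/
theorem leSign_eq_jwSign_mul_memSign (i : ι) (s : Finset ι) :
    leSign i s = jwSign i s * memSign s i := by
  rw [leSign, jwSign, memSign]
  have h : s.filter (· ≤ i) = s.filter (· < i) ∪ s.filter (· = i) := by
    ext a; simp only [mem_filter, mem_union, le_iff_lt_or_eq]; tauto
  rw [h, card_union_of_disjoint (disjoint_filter.2 fun a _ h1 h2 => by subst h2; exact lt_irrefl _ h1),
    pow_add]
  have hmem : (s.filter (· = i)).card = if i ∈ s then 1 else 0 := by
    split_ifs with hx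
    · rw [card_eq_one]; refine ⟨i, ?_⟩; ext a; simp only [mem_filter, mem_singleton]
      exact ⟨fun h => h.2, fun h => ⟨h ▸ hx, h⟩⟩
    · rw [card_eq_zero]; ext a; simp only [mem_filter, Finset.notMem_empty, iff_false, not_and]
      rintro ha rfl; exact hx ha
  rw [hmem]
  split_ifs <;> simp

/-- Lower sign × membership sign × upper sign `= (-1)^{#s}` (`leSign_mul_gtSign` of
`HubbardLiebConfig` with the bridge `leSign_eq_jwSign_mul_memSign`). [folklore] -/
theorem jwSign_mul_memSign_mul_gtSign (i : ι) (s : Finset ι) :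
    jwSign i s * memSign s i * gtSign i s = (-1) ^ s.card := by
  rw [← leSign_eq_jwSign_mul_memSign, leSign_mul_gtSign]

/-- For `i ∉ s`: lower sign × upper sign `= (-1)^{#s}`. [folklore] -/
theorem jwSign_mul_gtSign_of_notMem {i : ι} {s : Finset ι} (hi : i ∉ s) :
    jwSign i s * gtSign i s = (-1) ^ s.card := by
  rw [← jwSign_mul_memSign_mul_gtSign i s, memSign, if_neg hi, mul_one]

/-- The upper sign `gtSign` of `i` with respect to `insert j s`, `j > i`, flips. [folklore] -/
theorem gtSign_insert_of_gt {i j : ι} {s : Finset ι} (hj : j ∉ s) (h : i < j) :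
    gtSign i (insert j s) = -gtSign i s := by
  unfold gtSign
  rw [filter_insert, if_pos h, card_insert_of_notMem (by simp [hj]), pow_succ]
  ring

/-- The upper sign of `i` with respect to `insert j s`, `j < i`, is unchanged. [folklore] -/
theorem gtSign_insert_of_lt {i j : ι} (s : Finset ι) (h : j < i) :
    gtSign i (insert j s) = gtSign i s := by
  unfold gtSign
  rw [filter_insert, if_neg (not_lt.2 h.le)]

/-- The upper sign does not see `i` itself. [folklore] -/
@[simp] theorem gtSign_insert_self (i : ι) (s : Finset ι) :
    gtSign i (insert i s) = gtSign i s := by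
  unfold gtSign
  rw [filter_insert, if_neg (lt_irrefl i)]

/-- The upper sign does not see `i` itself (erase). [folklore] -/
@[simp] theorem gtSign_erase_self (i : ι) (s : Finset ι) :
    gtSign i (s.erase i) = gtSign i s := by
  unfold gtSign
  rw [filter_erase, erase_eq_of_notMem]
  simp

/-- Reciprocity of lower signs for two distinct orbitals `i ≠ j ∉ s`: inserting the other orbital
flips exactly one of `jwSign i`, `jwSign j`. [folklore] -/
theorem jwSign_pair_swap {i j : ι} (hij : i ≠ j) (s : Finset ι) (hi : i ∉ s) (hj : j ∉ s) :
    jwSign i (insert j s) * jwSign j (insert i s) = -(jwSign i s * jwSign j s) := by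
  rcases lt_or_gt_of_ne hij with h | h
  · rw [jwSign_insert_of_not_lt (s := s) (lt_asymm h), jwSign_insert_of_lt hi h]; ring
  · rw [jwSign_insert_of_lt hj h, jwSign_insert_of_not_lt (s := s) (lt_asymm h)]; ring

end Fock

/-! ### Two-species coordinates on the Hubbard Fock space -/

section Orbitals

variable {Λ : Type*} [LinearOrder Λ] [Fintype Λ]

/-- Jordan–Wigner sign of a down orbital with the membership sign made explicit:
`jwSign (x↓) (α↑ ∪ γ↓) = jwSign x α · (-1)^{[x ∈ α]} · jwSign x γ` (`jwSign_orb_one` of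
`HubbardLiebConfig` and the bridge `leSign_eq_jwSign_mul_memSign`). [folklore] -/
theorem jwSign_orb_one_eq (x : Λ) (α γ : Finset Λ) :
    jwSign (orb x 1) (pairSet α γ) = jwSign x α * memSign α x * jwSign x γ := by
  rw [jwSign_orb_one, leSign_eq_jwSign_mul_memSign]

end Orbitals

/-! ### Explicit action of the Hubbard operators in two-species coordinates -/

section Actions

variable {Λ : Type*} [LinearOrder Λ] [Fintype Λ]

/-- `n_{xσ}` is the occupation indicator: `(n_{xσ} ψ)(s) = [(x,σ) ∈ s] ψ(s)`. [folklore] -/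
theorem numberOp_mulVec (x : Λ) (σ : Fin 2) (ψ : Fock (Orb Λ)) (s : Finset (Orb Λ)) :
    (numberOp x σ *ᵥ ψ) s = if orb x σ ∈ s then ψ s else 0 := by
  rw [numberOp_eq_diagonal, mulVec_diagonal]
  split_ifs <;> simp

/-- `n_{x↑} n_{x↓}` is the double-occupancy indicator. [folklore] -/
theorem numberOp_mul_numberOp_mulVec (x : Λ) (ψ : Fock (Orb Λ)) (s : Finset (Orb Λ)) :
    ((numberOp x 0 * numberOp x 1) *ᵥ ψ) s = if orb x 0 ∈ s ∧ orb x 1 ∈ s then ψ s else 0 := by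
  rw [← mulVec_mulVec, numberOp_mulVec, numberOp_mulVec]
  by_cases h0 : orb x 0 ∈ s <;> by_cases h1 : orb x 1 ∈ s <;> simp [h0, h1]

/-- The total number operator multiplies by the particle number. [folklore] -/
theorem totalNumber_mulVec (ψ : Fock (Orb Λ)) (s : Finset (Orb Λ)) :
    (totalNumber *ᵥ ψ) s = (s.card : ℂ) * ψ s := by
  rw [← Literature.MathematicalPhysics.QuantumLattice.totalNumberOp_eq_totalNumber, Literature.MathematicalPhysics.QuantumLattice.totalNumberOp_eq_diagonal,
    mulVec_diagonal]

/-- Hopping of an up electron from `y` to `x` in two-species coordinates: the Jordan–Wigner sign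
factorises as (spinless sign of the move inside `α`) × `jwSign x γ · jwSign y γ`. [folklore] -/
theorem hopUp_mulVec_pairSet (x y : Λ) (ψ : Fock (Orb Λ)) (α γ : Finset Λ) :
    ((creation (orb x 0) * annihilation (orb y 0)) *ᵥ ψ) (pairSet α γ) =
      if x ∈ α ∧ y ∉ α.erase x then
        jwSign x α * jwSign y (α.erase x) * (jwSign x γ * jwSign y γ) *
          ψ (pairSet (insert y (α.erase x)) γ) else 0 := by
  rw [creation_mul_annihilation_mulVec_apply, pairSet_erase_zero, pairSet_insert_zero]
  simp only [orb_zero_mem_pairSet, jwSign_orb_zero, jwSign_erase_of_not_lt (lt_irrefl _)]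
  split_ifs
  · ring
  · rfl

/-- Hopping of a down electron from `y` to `x` in two-species coordinates: the Jordan–Wigner sign
factorises as `jwSign x α (-1)^{[x∈α]} jwSign y α (-1)^{[y∈α]}` × (spinless sign of the move
inside `γ`). [folklore] -/
theorem hopDn_mulVec_pairSet (x y : Λ) (ψ : Fock (Orb Λ)) (α γ : Finset Λ) :
    ((creation (orb x 1) * annihilation (orb y 1)) *ᵥ ψ) (pairSet α γ) =
      if x ∈ γ ∧ y ∉ γ.erase x then
        jwSign x α * memSign α x * (jwSign y α * memSign α y) * (jwSign x γ * jwSign y (γ.erase x)) *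
          ψ (pairSet α (insert y (γ.erase x))) else 0 := by
  rw [creation_mul_annihilation_mulVec_apply, pairSet_erase_one, pairSet_insert_one]
  simp only [orb_one_mem_pairSet, jwSign_orb_one_eq, jwSign_erase_of_not_lt (lt_irrefl _)]
  split_ifs
  · ring
  · rfl

/-- On-site spin flip `c†_{x↑} c_{x↓}` acts **without sign** in the site-major Jordan–Wigner
convention (the two orbitals of a site are adjacent). [folklore] -/
theorem flipUp_mulVec_pairSet (x : Λ) (ψ : Fock (Orb Λ)) (α γ : Finset Λ) :
    ((creation (orb x 0) * annihilation (orb x 1)) *ᵥ ψ) (pairSet α γ) =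
      if x ∈ α ∧ x ∉ γ then ψ (pairSet (α.erase x) (insert x γ)) else 0 := by
  rw [creation_mul_annihilation_mulVec_apply, pairSet_erase_zero, pairSet_insert_one]
  simp only [orb_zero_mem_pairSet, orb_one_mem_pairSet, jwSign_orb_zero, jwSign_orb_one_eq,
    jwSign_erase_of_not_lt (lt_irrefl _), memSign, if_neg (Finset.notMem_erase x α), mul_one]
  split_ifs
  · have h1 := jwSign_mul_self x α
    have h2 := jwSign_mul_self x γ
    linear_combination (jwSign x γ * jwSign x γ * ψ (pairSet (α.erase x) (insert x γ))) * h1 +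
      ψ (pairSet (α.erase x) (insert x γ)) * h2
  · rfl

/-- On-site spin flip `c†_{x↓} c_{x↑}` acts without sign. [folklore] -/
theorem flipDn_mulVec_pairSet (x : Λ) (ψ : Fock (Orb Λ)) (α γ : Finset Λ) :
    ((creation (orb x 1) * annihilation (orb x 0)) *ᵥ ψ) (pairSet α γ) =
      if x ∈ γ ∧ x ∉ α then ψ (pairSet (insert x α) (γ.erase x)) else 0 := by
  rw [creation_mul_annihilation_mulVec_apply, pairSet_erase_one, pairSet_insert_zero]
  simp only [orb_zero_mem_pairSet, orb_one_mem_pairSet, jwSign_orb_zero, jwSign_orb_one_eq,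
    jwSign_erase_of_not_lt (lt_irrefl _)]
  by_cases h : x ∈ γ ∧ x ∉ α
  · rw [if_pos h, if_pos h, memSign, if_neg h.2]
    have h1 := jwSign_mul_self x α
    have h2 := jwSign_mul_self x γ
    linear_combination (jwSign x γ * jwSign x γ * ψ (pairSet (insert x α) (γ.erase x))) * h1 +
      ψ (pairSet (insert x α) (γ.erase x)) * h2
  · rw [if_neg h, if_neg h]

/-- `S⁺` in two-species coordinates: `(S⁺ψ)(α↑ ∪ γ↓) = Σ_{x ∈ α ∖ γ} ψ((α∖x)↑ ∪ (γ ∪ x)↓)`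
(no Jordan–Wigner signs). Lieb, PRL 62 (1989) 1201, eq. (2). [cite: LiebPRL1989, eq. (2)] -/
theorem spinPlus_mulVec_pairSet (ψ : Fock (Orb Λ)) (α γ : Finset Λ) :
    (spinPlus *ᵥ ψ) (pairSet α γ) = ∑ x ∈ α \ γ, ψ (pairSet (α.erase x) (insert x γ)) := by
  rw [spinPlus, Matrix.sum_mulVec, Finset.sum_apply]
  simp only [flipUp_mulVec_pairSet]
  rw [← Finset.sum_filter]
  congr 1
  ext x; simp

/-- `S⁻ = spinMinus (= (S⁺)ᴴ)` in two-species coordinates: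
`(S⁻ψ)(α↑ ∪ γ↓) = Σ_{x ∈ γ ∖ α} ψ((α ∪ x)↑ ∪ (γ∖x)↓)` (no Jordan–Wigner signs).
Lieb, PRL 62 (1989) 1201, eq. (2). [cite: LiebPRL1989, eq. (2)] -/
theorem spinMinus_mulVec_pairSet (ψ : Fock (Orb Λ)) (α γ : Finset Λ) :
    (Literature.MathematicalPhysics.QuantumLattice.spinMinus *ᵥ ψ) (pairSet α γ) = ∑ x ∈ γ \ α, ψ (pairSet (insert x α) (γ.erase x)) := by
  rw [Literature.MathematicalPhysics.QuantumLattice.spinMinus_eq_sum, Matrix.sum_mulVec, Finset.sum_apply]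
  simp only [flipDn_mulVec_pairSet]
  rw [← Finset.sum_filter]
  congr 1
  ext x; simp

end Actions

/-! ### Symmetries of the Hubbard Hamiltonian: complements to `HubbardWave0LiebProofs`

`[H, S^±] = 0`, `H` Hermitian, `[S⁺, S⁻] = 2S^z`, sector preservation and the discharge of
`hamiltonian_isHermitian_and_commute` are in `HubbardWave0LiebProofs` (namespace `LiebThm1`); here only
the second `su(2)` relation `[S^z, S⁺] = S⁺` and the discharge of `FermionOperators.spin_su2_relations`. -/

section Symmetries

variable {ι : Type*} [LinearOrder ι] [Fintype ι] {Λ : Type*} [LinearOrder Λ] [Fintype Λ]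

/-- Commutator with a diagonal matrix, entrywise: `([D, P])_{st} = (d_s - d_t) P_{st}`. [folklore] -/
theorem diagonal_commutator_apply (d : Finset ι → ℂ) (P : Matrix (Finset ι) (Finset ι) ℂ)
    (s t : Finset ι) : (diagonal d * P - P * diagonal d) s t = (d s - d t) * P s t := by
  rw [Matrix.sub_apply, diagonal_mul, mul_diagonal]; ring

/-- Support of the on-site flip `c†_{z↑} c_{z↓}`: a nonzero entry `⟨s| · |t⟩` forces
`t = (s ∖ (z,↑)) ∪ (z,↓)` with `(z,↑) ∈ s`, `(z,↓) ∉ s`. [folklore] -/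
theorem flipUp_apply_ne_zero {z : Λ} {s t : Finset (Orb Λ)}
    (h : (creation (orb z 0) * annihilation (orb z 1)) s t ≠ 0) :
    orb z 0 ∈ s ∧ orb z 1 ∉ s ∧ t = insert (orb z 1) (s.erase (orb z 0)) := by
  rw [creation_mul_annihilation_apply] at h
  by_cases hc : orb z 0 ∈ s ∧ orb z 1 ∉ s.erase (orb z 0) ∧ t = insert (orb z 1) (s.erase (orb z 0))
  · refine ⟨hc.1, fun h1 => hc.2.1 ?_, hc.2.2⟩
    exact Finset.mem_erase.2 ⟨by simp, h1⟩
  · exact absurd (if_neg hc) h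

/-- Support of a hopping term `c†_i c_j`: a nonzero entry `⟨s| · |t⟩` forces
`t = (s ∖ i) ∪ j` with `i ∈ s`, `j ∉ s ∖ i`. [folklore] -/
theorem creation_mul_annihilation_apply_ne_zero {i j : ι} {s t : Finset ι}
    (h : (creation i * annihilation j) s t ≠ 0) :
    i ∈ s ∧ j ∉ s.erase i ∧ t = insert j (s.erase i) := by
  rw [creation_mul_annihilation_apply] at h
  by_contra hc
  exact h (if_neg hc)

/-- A diagonal matrix whose diagonal is invariant under on-site spin flips commutes with `S⁺`.
[folklore] -/
theorem diagonal_mul_spinPlus_of_flip_invariant (d : Finset (Orb Λ) → ℂ)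
    (hd : ∀ (z : Λ) (s : Finset (Orb Λ)), orb z 0 ∈ s → orb z 1 ∉ s →
      d s = d (insert (orb z 1) (s.erase (orb z 0)))) :
    diagonal d * spinPlus = spinPlus * diagonal d := by
  rw [← sub_eq_zero]
  ext s t
  rw [diagonal_commutator_apply, Matrix.zero_apply, spinPlus, Matrix.sum_apply, Finset.mul_sum]
  refine Finset.sum_eq_zero fun z _ => ?_
  by_cases h : (creation (orb z 0) * annihilation (orb z 1)) s t = 0
  · rw [h, mul_zero]
  · obtain ⟨h0, h1, rfl⟩ := flipUp_apply_ne_zero h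
    rw [hd z s h0 h1, sub_self, zero_mul]

/-- `[S^z, S⁺] = S⁺`. Tasaki (2020) §9.3, (9.3.6). [folklore] -/
theorem spinZ_mul_spinPlus_sub :
    (HubbardWave0.spinZ * spinPlus - spinPlus * HubbardWave0.spinZ : Matrix (Finset (Orb Λ)) _ ℂ) = spinPlus := by
  rw [spinZ_eq_diagonal]
  ext s s'
  rw [diagonal_commutator_apply, spinPlus, Matrix.sum_apply, Finset.mul_sum]
  refine Finset.sum_congr rfl fun z _ => ?_
  by_cases h : (creation (orb z 0) * annihilation (orb z 1)) s s' = 0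
  · rw [h, mul_zero]
  · obtain ⟨h0, h1, rfl⟩ := flipUp_apply_ne_zero h
    have ht : insert (orb z 1) (s.erase (orb z 0)) = pairSet ((upPart s).erase z) (insert z (downPart s)) := by
      conv_lhs => rw [← pairSet_upPart_downPart s]
      rw [pairSet_erase_zero, pairSet_insert_one]
    have hu : upPart (insert (orb z 1) (s.erase (orb z 0))) = (upPart s).erase z := by rw [ht, upPart_pairSet]
    have hd : downPart (insert (orb z 1) (s.erase (orb z 0))) = insert z (downPart s) := by rw [ht, downPart_pairSet]
    have h0' : z ∈ upPart s := by rw [← pairSet_upPart_downPart s, orb_zero_mem_pairSet] at h0; exact h0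
    have h1' : z ∉ downPart s := by rw [← pairSet_upPart_downPart s, orb_one_mem_pairSet] at h1; exact h1
    rw [hu, hd, card_erase_of_mem h0', card_insert_of_notMem h1', Nat.cast_sub (card_pos.2 ⟨_, h0'⟩)]
    push_cast
    ring

/-- Discharge of the named fact `Literature.MathematicalPhysics.QuantumLattice.spin_su2_relations`: `[S⁺, S⁻] = 2S^z` and
`[S^z, S⁺] = S⁺`. Tasaki (2020) §9.3, (9.3.6). [folklore] -/
theorem spin_su2_relations_holds : Literature.MathematicalPhysics.QuantumLattice.spin_su2_relations (Λ := Λ) :=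
  ⟨spinPlus_mul_spinMinus_sub, spinZ_mul_spinPlus_sub⟩

end Symmetries

/-! ### Lieb's two-species change of basis `W ↦ ψ_W` -/

section TwoSpecies

variable {ι : Type*} [LinearOrder ι]

/-- General insertion rule for the Jordan–Wigner sign: inserting `j ∉ s` multiplies the sign of
`i` by `-1` exactly when `j < i`. [folklore] -/
theorem jwSign_insert {i j : ι} {s : Finset ι} (hj : j ∉ s) :
    jwSign i (insert j s) = (if j < i then -1 else 1) * jwSign i s := by
  by_cases h : j < i
  · rw [jwSign_insert_of_lt hj h, if_pos h]; ring
  · rw [if_neg h, one_mul]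
    rcases eq_or_lt_of_le (not_lt.1 h) with h' | h'
    · subst h'; exact jwSign_insert_of_not_lt (s := s) (lt_irrefl _)
    · exact jwSign_insert_of_not_lt (s := s) (lt_asymm h')

/-- General insertion rule for the upper sign `gtSign`. [folklore] -/
theorem gtSign_insert {i j : ι} {s : Finset ι} (hj : j ∉ s) :
    gtSign i (insert j s) = (if i < j then -1 else 1) * gtSign i s := by
  by_cases h : i < j
  · rw [gtSign_insert_of_gt hj h, if_pos h]; ring
  · rw [if_neg h, one_mul]
    rcases eq_or_lt_of_le (not_lt.1 h) with h' | h'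
    · subst h'; exact gtSign_insert_self _ s
    · exact gtSign_insert_of_lt s h'

/-- Dual form of `σ = pairSign`: `Π_{a∈α} jwSign a γ = Π_{z∈γ} gtSign z α` (both count the pairs
`z < a`). [folklore] -/
theorem pairSign_eq_prod_gtSign (α γ : Finset ι) :
    pairSign α γ = ∏ z ∈ γ, gtSign z α := by
  unfold pairSign jwSign gtSign
  rw [Finset.prod_pow_eq_pow_sum, Finset.prod_pow_eq_pow_sum]
  congr 1
  simp only [Finset.card_filter]
  exact Finset.sum_comm

variable [Fintype ι]

/-- Lieb's hole–particle sign `κ_A(β) = Π_{z ∈ β} ε(z) (-1)^{pos z}` with `ε = -1` on `A` and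
`+1` on `B = Aᶜ` and `pos z = #{w | w < z}`: the sign making the hole-hopping matrix of one
spin species equal to the particle-hopping matrix of the other on a bipartite graph
("hole–particle transformation … followed by a sign change on the `B` sublattice"). It is the
weight `Π_{i ∈ β} conj(ε i) · jwSign i univ` of the particle–hole transformation
`Literature.QLattice.particleHole ε` of `FermionOperators` for the real phases `ε = memSign A`
(`particleHole_memSign_apply`). [cite: LiebPRL1989, proof of Theorem 2, eq. (5)] -/
def kappaSign (A β : Finset ι) : ℂ := ∏ z ∈ β, (memSign A z * jwSign z univ)

/-- `kappaSign A` is the weight of `particleHole (memSign A)`: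
`particleHole (memSign A) t s = [t = sᶜ] κ_A(s)`. [folklore] -/
theorem particleHole_memSign_apply (A t s : Finset ι) :
    Literature.MathematicalPhysics.QuantumLattice.particleHole (memSign A) t s = if t = sᶜ then kappaSign A s else 0 := by
  unfold Literature.MathematicalPhysics.QuantumLattice.particleHole kappaSign
  simp only [star_memSign]

/-- `κ(insert x ρ) = ε(x) (-1)^{pos x} κ(ρ)` for `x ∉ ρ`. [folklore] -/
theorem kappaSign_insert (A : Finset ι) {x : ι} {ρ : Finset ι} (hx : x ∉ ρ) :
    kappaSign A (insert x ρ) = memSign A x * jwSign x univ * kappaSign A ρ := by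
  unfold kappaSign; rw [Finset.prod_insert hx]

/-- `κ` is a sign. [folklore] -/
theorem kappaSign_mul_self (A β : Finset ι) : kappaSign A β * kappaSign A β = 1 := by
  unfold kappaSign
  rw [← Finset.prod_mul_distrib]
  refine Finset.prod_eq_one fun z _ => ?_
  calc memSign A z * jwSign z univ * (memSign A z * jwSign z univ)
      = (memSign A z * memSign A z) * (jwSign z univ * jwSign z univ) := by ring
    _ = 1 := by rw [memSign_mul_self, jwSign_mul_self, one_mul]

/-- `κ` is real. [folklore] -/
theorem star_kappaSign (A β : Finset ι) : star (kappaSign A β) = kappaSign A β := by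
  unfold kappaSign memSign; rw [star_prod]
  refine Finset.prod_congr rfl fun z _ => ?_
  split_ifs <;> simp

/-- **The key sign identity behind Lieb's hole–particle transformation.** If `x ≠ y` are
adjacent sites of a bipartite graph (`x ∈ A ↔ y ∉ A`), `Λ = ρ ⊔ τ ⊔ {x, y}`, then
`jwSign x τ · jwSign y τ · κ(ρ ∪ x) = κ(ρ ∪ y) · jwSign x ρ · jwSign y ρ`: the Jordan–Wigner sign of
the down-electron move `x → y` (holes `ρ ∪ y → ρ ∪ x`) in the configuration `τ ∪ x`, corrected by
`κ`, equals the sign of the particle move `y → x` in the hole configuration. [cite: LiebPRL1989, proof of Theorem 2] -/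
theorem kappaSign_exchange (A : Finset ι) {x y : ι} {ρ τ : Finset ι} (hxy : x ≠ y)
    (hxρ : x ∉ ρ) (hyρ : y ∉ ρ) (hxτ : x ∉ τ) (hyτ : y ∉ τ) (hρτ : Disjoint ρ τ)
    (huniv : insert x (insert y (ρ ∪ τ)) = univ) (hA : x ∈ A ↔ y ∉ A) :
    jwSign x τ * jwSign y τ * kappaSign A (insert x ρ) =
      kappaSign A (insert y ρ) * (jwSign x ρ * jwSign y ρ) := by
  rw [kappaSign_insert A hxρ, kappaSign_insert A hyρ, ← huniv]
  have hxS : x ∉ insert y (ρ ∪ τ) := by simp [hxy, hxρ, hxτ]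
  have hyS : y ∉ ρ ∪ τ := by simp [hyρ, hyτ]
  have hxS' : x ∉ ρ ∪ τ := by simp [hxρ, hxτ]
  have hx' : jwSign x (insert x (insert y (ρ ∪ τ))) = (if y < x then -1 else 1) * (jwSign x ρ * jwSign x τ) := by
    rw [jwSign_insert_of_not_lt (lt_irrefl _), jwSign_insert hyS, jwSign_union hρτ]
  have hy' : jwSign y (insert x (insert y (ρ ∪ τ))) = (if x < y then -1 else 1) * (jwSign y ρ * jwSign y τ) := by
    rw [jwSign_insert hxS, jwSign_insert_of_not_lt (lt_irrefl _), jwSign_union hρτ]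
  rw [hx', hy']
  have hm : memSign A x = -memSign A y := by
    unfold memSign
    by_cases hx : x ∈ A
    · rw [if_pos hx, if_neg (hA.1 hx)]
    · rw [if_neg hx, if_pos (not_not.1 fun h => hx (hA.2 h)), neg_neg]
  have hs : (if y < x then (-1 : ℂ) else 1) = -(if x < y then -1 else 1) := by
    rcases lt_or_gt_of_ne hxy with h | h
    · rw [if_pos h, if_neg (lt_asymm h), neg_neg]
    · rw [if_neg (lt_asymm h), if_pos h]
  rw [hm, hs]
  have h1 := jwSign_mul_self x τ
  have h2 := jwSign_mul_self y ρ
  set sxy := (if x < y then (-1 : ℂ) else 1)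
  linear_combination (memSign A y * sxy * jwSign x ρ * jwSign y τ * kappaSign A ρ) * h1 -
    (memSign A y * sxy * jwSign y τ * kappaSign A ρ * jwSign x ρ) * h2

end TwoSpecies

section ChangeOfBasis

variable {Λ : Type*} [LinearOrder Λ] [Fintype Λ]

/-- Lieb's change of basis on the whole Fock space: a coefficient matrix `M : (Finset Λ)² → ℂ`
(rows = up-spin configurations `α`, columns = down-spin **hole** configurations `β`) is sent to
the Fock vector `ψ_M(α↑ ∪ γ↓) = σ(α,γ) κ_A(γᶜ) M(α, γᶜ)` (`σ = pairSign`); this is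
`ψ = Σ W_αβ ψ^α ⊗ ψ^β` of the PRL composed with the hole–particle transformation and written in
the site-major occupation basis of `HubbardWave0`. **Convention:** Lieb (proof of Theorem 2)
transforms the spin-up species (`c_{x↑} → ε(x) c†_{x↑}`, down unaltered); here, equivalently by the
`↑ ↔ ↓` symmetry, the **down** species is transformed (columns = down holes), so the one-body
term of eq. (5) appears as `U N_↑`. [cite: LiebPRL1989, proof of Theorems 1 and 2] -/
def toFock (A : Finset Λ) (M : Matrix (Finset Λ) (Finset Λ) ℂ) : Fock (Orb Λ) :=
  fun s => pairSign (upPart s) (downPart s) * kappaSign A (downPart s)ᶜ * M (upPart s) (downPart s)ᶜ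

/-- The inverse change of basis. [cite: LiebPRL1989, proof of Theorems 1 and 2] -/
def ofFock (A : Finset Λ) (ψ : Fock (Orb Λ)) : Matrix (Finset Λ) (Finset Λ) ℂ :=
  fun a b => pairSign a bᶜ * kappaSign A b * ψ (pairSet a bᶜ)

/-- Value of `toFock` on a configuration written in two-species coordinates. [folklore] -/
theorem toFock_pairSet (A : Finset Λ) (M : Matrix (Finset Λ) (Finset Λ) ℂ) (α γ : Finset Λ) :
    toFock A M (pairSet α γ) = pairSign α γ * kappaSign A γᶜ * M α γᶜ := by
  simp [toFock]

/-- `toFock ∘ ofFock = id`. [folklore] -/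
theorem toFock_ofFock (A : Finset Λ) (ψ : Fock (Orb Λ)) : toFock A (ofFock A ψ) = ψ := by
  funext s
  conv_rhs => rw [← pairSet_upPart_downPart s]
  rw [← pairSet_upPart_downPart s, toFock_pairSet, ofFock, compl_compl, upPart_pairSet, downPart_pairSet]
  have h1 := pairSign_mul_self (upPart s) (downPart s)
  have h2 := kappaSign_mul_self A (downPart s)ᶜ
  linear_combination (kappaSign A (downPart s)ᶜ * kappaSign A (downPart s)ᶜ * ψ (pairSet (upPart s) (downPart s))) * h1 +
    ψ (pairSet (upPart s) (downPart s)) * h2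

/-- `ofFock ∘ toFock = id`. [folklore] -/
theorem ofFock_toFock (A : Finset Λ) (M : Matrix (Finset Λ) (Finset Λ) ℂ) : ofFock A (toFock A M) = M := by
  ext a b
  rw [ofFock, toFock_pairSet, compl_compl]
  have h1 := pairSign_mul_self a bᶜ
  have h2 := kappaSign_mul_self A b
  linear_combination (kappaSign A b * kappaSign A b * M a b) * h1 + M a b * h2

/-- `toFock` is additive. [folklore] -/
theorem toFock_add (A : Finset Λ) (M M' : Matrix (Finset Λ) (Finset Λ) ℂ) :
    toFock A (M + M') = toFock A M + toFock A M' := by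
  funext s; simp only [toFock, Matrix.add_apply, Pi.add_apply]; ring

/-- `toFock` is homogeneous. [folklore] -/
theorem toFock_smul (A : Finset Λ) (c : ℂ) (M : Matrix (Finset Λ) (Finset Λ) ℂ) :
    toFock A (c • M) = c • toFock A M := by
  funext s; simp only [toFock, Matrix.smul_apply, Pi.smul_apply, smul_eq_mul]; ring

/-- `toFock` respects subtraction. [folklore] -/
theorem toFock_sub (A : Finset Λ) (M M' : Matrix (Finset Λ) (Finset Λ) ℂ) :
    toFock A (M - M') = toFock A M - toFock A M' := by
  funext s; simp only [toFock, Matrix.sub_apply, Pi.sub_apply]; ring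

/-- `toFock 0 = 0`. [folklore] -/
@[simp] theorem toFock_zero (A : Finset Λ) : toFock A (0 : Matrix (Finset Λ) (Finset Λ) ℂ) = 0 := by
  funext s; simp [toFock]

/-- `toFock` is injective. [folklore] -/
theorem toFock_injective (A : Finset Λ) : Function.Injective (toFock (Λ := Λ) A) := fun M M' h => by
  rw [← ofFock_toFock A M, h, ofFock_toFock]

/-- The bijection `s ↦ (up-spin sites, down-spin **holes**)` between configurations and pairs of
subsets (hole–particle transformed coordinates; `Literature.MathematicalPhysics.QuantumLattice.configEquiv` of `HubbardLiebConfig`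
is the untransformed `s ↦ (ups, downs)`). [folklore] -/
def holeConfigEquiv : Finset (Orb Λ) ≃ Finset Λ × Finset Λ :=
  configEquiv.trans (Equiv.prodCongr (Equiv.refl _) ⟨compl, compl, compl_compl, compl_compl⟩)

/-- `holeConfigEquiv s = (ups, (downs)ᶜ)`. [folklore] -/
@[simp] theorem holeConfigEquiv_apply (s : Finset (Orb Λ)) :
    holeConfigEquiv s = (upPart s, (downPart s)ᶜ) := rfl

/-- **`toFock` is unitary** for the Hilbert–Schmidt inner product `hsInner` of `LiebSpinReflection`
(Lieb: "`⟨ψ|ψ⟩ = Σ |W_αβ|² = Tr W²`", the sentence before eq. (3); the transformed analogue of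
`LiebThm1.hsInner_liebW`): `⟨ψ_M, ψ_M'⟩ = ⟨M, M'⟩_HS`. [cite: LiebPRL1989, proof of Theorem 1] -/
theorem star_toFock_dotProduct_toFock (A : Finset Λ) (M M' : Matrix (Finset Λ) (Finset Λ) ℂ) :
    star (toFock A M) ⬝ᵥ toFock A M' = hsInner M M' := by
  rw [hsInner_apply, dotProduct, ← Fintype.sum_prod_type']
  refine Fintype.sum_equiv holeConfigEquiv _ _ fun s => ?_
  simp only [Pi.star_apply, toFock, holeConfigEquiv_apply, star_mul', star_pairSign, star_kappaSign]
  have h1 := pairSign_mul_self (upPart s) (downPart s)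
  have h2 := kappaSign_mul_self A (downPart s)ᶜ
  linear_combination (kappaSign A (downPart s)ᶜ * kappaSign A (downPart s)ᶜ * star (M (upPart s) (downPart s)ᶜ) *
      M' (upPart s) (downPart s)ᶜ) * h1 + (star (M (upPart s) (downPart s)ᶜ) * M' (upPart s) (downPart s)ᶜ) * h2

end ChangeOfBasis

section Intertwiner

variable {Λ : Type*} [LinearOrder Λ] [Fintype Λ]

omit [Fintype Λ] in
/-- Sign bookkeeping for an up-electron move `x → y` (`x ∈ α`, `y ∉ α ∖ x`):
`jwSign x γ · jwSign y γ · σ(α - x + y, γ) = σ(α, γ)` (`σ = pairSign`). [folklore] -/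
theorem pairSign_move_left {x y : Λ} {α : Finset Λ} (hx : x ∈ α) (hy : y ∉ α.erase x) (γ : Finset Λ) :
    jwSign x γ * jwSign y γ * pairSign (insert y (α.erase x)) γ = pairSign α γ := by
  rw [pairSign_insert_left hy]
  conv_rhs => rw [← Finset.insert_erase hx, pairSign_insert_left (Finset.notMem_erase x α)]
  have h := jwSign_mul_self y γ
  linear_combination (jwSign x γ * pairSign (α.erase x) γ) * h

/-- Sign bookkeeping for a down-electron move `x → y` in Lieb's twisted basis (the heart of the
hole–particle transformation): with `Λ = ρ ⊔ τ ⊔ {x,y}`, `x ≠ y` adjacent across the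
bipartition, up-spins `α`, down-spins `γ = τ ∪ x` before and `τ ∪ y` after the move (holes
`ρ ∪ y` before, `ρ ∪ x` after), the site-major Jordan–Wigner sign of `c†_{y↓} c_{x↓}` times the
new `σκ` equals the old `σκ` times the spinless sign of the hole move `y → x` (`σ = pairSign`,
`κ = kappaSign`). [cite: LiebPRL1989, proof of Theorem 2] -/
theorem pairSignKappa_move_right (A : Finset Λ) {x y : Λ} {α ρ τ : Finset Λ} (hxy : x ≠ y)
    (hxρ : x ∉ ρ) (hyρ : y ∉ ρ) (hxτ : x ∉ τ) (hyτ : y ∉ τ) (hρτ : Disjoint ρ τ)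
    (huniv : insert x (insert y (ρ ∪ τ)) = univ) (hA : x ∈ A ↔ y ∉ A) :
    jwSign x α * memSign α x * (jwSign y α * memSign α y) * (jwSign x (insert x τ) * jwSign y τ) *
        (pairSign α (insert y τ) * kappaSign A (insert x ρ)) =
      pairSign α (insert x τ) * kappaSign A (insert y ρ) * (jwSign y (insert y ρ) * jwSign x ρ) := by
  -- `jwSign z α · (-1)^{[z ∈ α]} = (-1)^{#α} gtSign z α` (from `leSign_mul_gtSign`)
  have hms : ∀ z : Λ, jwSign z α * memSign α z = (-1) ^ α.card * gtSign z α := fun z => by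
    have h := jwSign_mul_memSign_mul_gtSign z α
    have h2 := gtSign_mul_self z α
    linear_combination gtSign z α * h - (jwSign z α * memSign α z) * h2
  rw [hms x, hms y, jwSign_insert_of_not_lt (lt_irrefl _), jwSign_insert_of_not_lt (lt_irrefl _),
    pairSign_insert_right α hyτ, pairSign_insert_right α hxτ]
  have hK := kappaSign_exchange A hxy hxρ hyρ hxτ hyτ hρτ huniv hA
  calc (-1) ^ α.card * gtSign x α * ((-1) ^ α.card * gtSign y α) * (jwSign x τ * jwSign y τ) *
        (gtSign y α * pairSign α τ * kappaSign A (insert x ρ))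
      = ((-1) ^ α.card * (-1) ^ α.card) * (gtSign y α * gtSign y α) *
          (gtSign x α * pairSign α τ) * (jwSign x τ * jwSign y τ * kappaSign A (insert x ρ)) := by ring
    _ = 1 * 1 * (gtSign x α * pairSign α τ) * (kappaSign A (insert y ρ) * (jwSign x ρ * jwSign y ρ)) := by
      rw [hK, gtSign_mul_self, ← mul_pow, neg_mul_neg, one_mul, one_pow]; ring
    _ = _ := by ring

/-- `pairSignKappa_move_right` in invariant form: for adjacent `x ≠ y` across the bipartition with
`x ∈ γ`, `y ∉ γ` (down-electron at `x` hops to `y`; in hole language the hole at `y` hops to `x`).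
[cite: LiebPRL1989, proof of Theorem 2] -/
theorem pairSignKappa_move_right' (A : Finset Λ) {x y : Λ} (hxy : x ≠ y) (hA : x ∈ A ↔ y ∉ A)
    {γ : Finset Λ} (hx : x ∈ γ) (hy : y ∉ γ) (α : Finset Λ) :
    jwSign x α * memSign α x * (jwSign y α * memSign α y) * (jwSign x γ * jwSign y (γ.erase x)) *
        (pairSign α (insert y (γ.erase x)) * kappaSign A (insert y (γ.erase x))ᶜ) =
      pairSign α γ * kappaSign A γᶜ * (jwSign y γᶜ * jwSign x (γᶜ.erase y)) := by
  obtain ⟨τ, hxτ, rfl⟩ : ∃ τ, x ∉ τ ∧ γ = insert x τ := ⟨γ.erase x, Finset.notMem_erase x γ, (insert_erase hx).symm⟩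
  have hyτ : y ∉ τ := fun h => hy (mem_insert_of_mem h)
  set ρ := (insert x τ)ᶜ.erase y with hρ
  have hyρ : y ∉ ρ := Finset.notMem_erase y _
  have hxρ : x ∉ ρ := by
    rw [hρ, mem_erase, mem_compl]; exact fun h => h.2 (mem_insert_self x τ)
  have hβ : (insert x τ)ᶜ = insert y ρ := by
    rw [hρ, insert_erase]; rw [mem_compl]; exact hy
  have hmemρ : ∀ z, z ∈ ρ ↔ z ≠ y ∧ ¬(z = x ∨ z ∈ τ) := by
    intro z; rw [hρ, mem_erase, mem_compl, mem_insert]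
  have hc : (insert y ((insert x τ).erase x))ᶜ = insert x ρ := by
    rw [erase_insert hxτ]
    ext z
    rw [mem_compl, mem_insert, mem_insert, hmemρ]
    constructor
    · intro h
      by_cases hzx : z = x
      · exact Or.inl hzx
      · rw [not_or] at h
        exact Or.inr ⟨h.1, fun h' => h'.elim hzx h.2⟩
    · rintro (rfl | ⟨h1, h2⟩)
      · rw [not_or]; exact ⟨hxy, hxτ⟩
      · rw [not_or] at h2 ⊢; exact ⟨h1, h2.2⟩
  have hρτ : Disjoint ρ τ := by
    rw [Finset.disjoint_left]
    intro z hz hzτ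
    rw [hρ, mem_erase, mem_compl] at hz
    exact hz.2 (mem_insert_of_mem hzτ)
  have huniv : insert x (insert y (ρ ∪ τ)) = univ := by
    ext z
    simp only [mem_insert, mem_union, mem_univ, iff_true]
    by_cases hz : z ∈ insert x τ
    · rcases mem_insert.1 hz with h | h
      · exact Or.inl h
      · exact Or.inr (Or.inr (Or.inr h))
    · rw [← mem_compl, hβ, mem_insert] at hz
      rcases hz with h | h
      · exact Or.inr (Or.inl h)
      · exact Or.inr (Or.inr (Or.inl h))
  rw [hc, erase_insert hxτ, hβ]
  exact pairSignKappa_move_right A hxy hxρ hyρ hxτ hyτ hρτ huniv hA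

variable (G : SimpleGraph Λ) [DecidableRel G.Adj]

omit [LinearOrder Λ] [DecidableRel G.Adj] in
/-- A matrix of the form `if p then A else 0` acts as `if p then A v else 0`. [folklore] -/
theorem ite_zero_mulVec_apply {p : Prop} [Decidable p] (B : Matrix (Finset Λ) (Finset Λ) ℂ)
    (v : Finset Λ → ℂ) (a : Finset Λ) :
    ((if p then B else 0) *ᵥ v) a = if p then (B *ᵥ v) a else 0 := by
  split_ifs <;> simp

/-- Action of `K`: `(K f)(α) = -t Σ_{x∼y} [x∈α, y∉α∖x] jwSign x α jwSign y (α∖x) f(α - x + y)`. [folklore] -/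
theorem hoppingMatrix_mulVec (t : ℝ) (f : Finset Λ → ℂ) (α : Finset Λ) :
    (hoppingMatrix G t *ᵥ f) α = -(t : ℂ) * ∑ x : Λ, ∑ y : Λ, if G.Adj x y then
      (if x ∈ α ∧ y ∉ α.erase x then jwSign x α * jwSign y (α.erase x) * f (insert y (α.erase x)) else 0)
      else 0 := by
  unfold hoppingMatrix
  rw [smul_mulVec, Pi.smul_apply, smul_eq_mul, Matrix.sum_mulVec, Finset.sum_apply]
  congr 1
  refine Finset.sum_congr rfl fun x _ => ?_
  rw [Matrix.sum_mulVec, Finset.sum_apply]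
  refine Finset.sum_congr rfl fun y _ => ?_
  rw [ite_zero_mulVec_apply, creation_mul_annihilation_mulVec_apply, jwSign_erase_of_not_lt (lt_irrefl _)]

/-- `K` preserves the particle number. [folklore] -/
theorem hoppingMatrix_apply_ne_zero {t : ℝ} {a b : Finset Λ} (h : hoppingMatrix G t a b ≠ 0) : a.card = b.card := by
  unfold hoppingMatrix at h
  rw [Matrix.smul_apply, smul_eq_mul] at h
  have h' := right_ne_zero_of_mul h
  rw [Matrix.sum_apply] at h'
  obtain ⟨x, -, hx⟩ := Finset.exists_ne_zero_of_sum_ne_zero h'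
  rw [Matrix.sum_apply] at hx
  obtain ⟨y, -, hy⟩ := Finset.exists_ne_zero_of_sum_ne_zero hx
  by_cases hadj : G.Adj x y
  · rw [if_pos hadj] at hy
    obtain ⟨hi, hj, rfl⟩ := creation_mul_annihilation_apply_ne_zero hy
    rw [card_insert_of_notMem hj, card_erase_of_mem hi]
    exact (Nat.sub_add_cancel (card_pos.2 ⟨_, hi⟩)).symm
  · rw [if_neg hadj] at hy; exact absurd rfl hy

/-- `K` restricted to `n`-particle rows and columns is Lieb's matrix `liebK G t n` of
`HubbardLiebConfig`. [cite: LiebPRL1989, eq. (3)] -/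
theorem hoppingMatrix_submatrix (t : ℝ) (n : ℕ) :
    (hoppingMatrix G t).submatrix (Subtype.val : Config Λ n → Finset Λ) Subtype.val = liebK G t n := rfl

omit [DecidableRel G.Adj] in
/-- `n_x` restricted to `n`-particle rows and columns is Lieb's matrix `liebL n x` of
`HubbardLiebConfig`. [cite: LiebPRL1989, eq. (3)] -/
theorem numberAt_submatrix (n : ℕ) (x : Λ) :
    (Literature.MathematicalPhysics.QuantumLattice.numberAt x).submatrix (Subtype.val : Config Λ n → Finset Λ) Subtype.val = liebL n x := by
  rw [Literature.MathematicalPhysics.QuantumLattice.numberAt_eq_diagonal, submatrix_diagonal _ _ Subtype.val_injective, liebL]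
  rfl

/-- Lieb's operator (eq. (4) of the PRL) after the hole–particle transformation, written on all of
`ℓ²(Finset Λ) ⊗ ℓ²(Finset Λ)` with the generic `Literature.MathematicalPhysics.QuantumLattice.liebOp` of `LiebSpinReflection`:
`𝓛(M) = liebOp K n (-U) M + U N M = KM + MK - U Σ_x n_x M n_x + U N M` with `K = hoppingMatrix G t`
and the spinless number operators `n_x = numberAt x`, `N = totalNumberOp` (diagonal). On a
coefficient matrix supported on `n`-particle rows and columns, i.e. `M = ext W` with
`W : Matrix (Config Λ n) (Config Λ n) ℂ`, the blocks are Lieb's matrices of `HubbardLiebConfig`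
(`hoppingMatrix_submatrix`: `K ↦ liebK G t n`; `numberAt_submatrix`: `n_x ↦ liebL n x`) and the
last term is `U n M`, so that `𝓛(ext W) = ext (Literature.Hubbard.liebOp (liebK G t n) (liebL n) (-U) W) + U n · ext W`
(this block identity is proved in the sequel file on the half-filled sector, not here). [cite: LiebPRL1989, eq. (4)] -/
def liebOperator (t U : ℝ) (M : Matrix (Finset Λ) (Finset Λ) ℂ) : Matrix (Finset Λ) (Finset Λ) ℂ :=
  Literature.MathematicalPhysics.QuantumLattice.liebOp (hoppingMatrix G t) Literature.MathematicalPhysics.QuantumLattice.numberAt (-U) M +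
    (U : ℂ) • ((Literature.MathematicalPhysics.QuantumLattice.totalNumberOp : Matrix (Finset Λ) (Finset Λ) ℂ) * M)

/-- **Lieb's representation of the Hubbard Hamiltonian on coefficient matrices.** For a bipartite
graph with colour class `A`, the Hubbard Hamiltonian acts on `ψ_M = toFock A M` as Lieb's operator
acts on `M`: `H ψ_M = ψ_{KM + MK - UΣ_x n_x M n_x + U N M}` — both spin species see the **same**
real symmetric hopping matrix `K` (thanks to the sign `κ_A`), and the repulsion `U n_{x↑}n_{x↓}`
becomes the attractive `-U n_x ⊗ n_x` plus the one-body term `U N_↑`; this is eqs. (4)–(5) of the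
PRL in the occupation basis of `HubbardWave0` (with the down species hole-transformed instead of
Lieb's up species, see `toFock`). [cite: LiebPRL1989, proof of Theorem 2, eqs. (4)–(5)] -/
theorem hamiltonian_mulVec_toFock (A : Finset Λ) (hA : ∀ x y : Λ, G.Adj x y → (x ∈ A ↔ y ∉ A))
    (t U : ℝ) (M : Matrix (Finset Λ) (Finset Λ) ℂ) :
    hamiltonian G t U *ᵥ toFock A M = toFock A (liebOperator G t U M) := by
  funext s
  rw [← pairSet_upPart_downPart s]
  set α := upPart s
  set γ := downPart s
  set ψ := toFock A M with hψ
  -- the three pieces of the left-hand side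
  have hL : (hamiltonian G t U *ᵥ ψ) (pairSet α γ) =
      -(t : ℂ) * ((∑ x : Λ, ∑ y : Λ, if G.Adj x y then
          ((creation (orb x 0) * annihilation (orb y 0)) *ᵥ ψ) (pairSet α γ) else 0) +
        ∑ x : Λ, ∑ y : Λ, if G.Adj x y then
          ((creation (orb x 1) * annihilation (orb y 1)) *ᵥ ψ) (pairSet α γ) else 0) +
      (U : ℂ) * ∑ x : Λ, ((numberOp x 0 * numberOp x 1) *ᵥ ψ) (pairSet α γ) := by
    rw [hamiltonian, add_mulVec, smul_mulVec, smul_mulVec, Pi.add_apply, Pi.smul_apply, Pi.smul_apply,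
      smul_eq_mul, smul_eq_mul, Matrix.sum_mulVec, Finset.sum_apply, Matrix.sum_mulVec, Finset.sum_apply,
      ← Finset.sum_add_distrib]
    congr 2
    refine Finset.sum_congr rfl fun x _ => ?_
    rw [Matrix.sum_mulVec, Finset.sum_apply, ← Finset.sum_add_distrib]
    refine Finset.sum_congr rfl fun y _ => ?_
    rw [Matrix.sum_mulVec, Finset.sum_apply, Fin.sum_univ_two]
    by_cases h : G.Adj x y <;> simp [h]
  set β := γᶜ with hβ
  -- (L1) up-spin hopping
  have hL1 : (∑ x : Λ, ∑ y : Λ, if G.Adj x y then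
        ((creation (orb x 0) * annihilation (orb y 0)) *ᵥ ψ) (pairSet α γ) else 0) =
      pairSign α γ * kappaSign A β * ∑ x : Λ, ∑ y : Λ, if G.Adj x y then
        (if x ∈ α ∧ y ∉ α.erase x then jwSign x α * jwSign y (α.erase x) * M (insert y (α.erase x)) β else 0)
        else 0 := by
    rw [Finset.mul_sum]
    refine Finset.sum_congr rfl fun x _ => ?_
    rw [Finset.mul_sum]
    refine Finset.sum_congr rfl fun y _ => ?_
    by_cases hadj : G.Adj x y
    · rw [if_pos hadj, if_pos hadj, hψ, hopUp_mulVec_pairSet]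
      by_cases hc : x ∈ α ∧ y ∉ α.erase x
      · rw [if_pos hc, if_pos hc, toFock_pairSet]
        have hθ := pairSign_move_left hc.1 hc.2 γ
        calc jwSign x α * jwSign y (α.erase x) * (jwSign x γ * jwSign y γ) *
              (pairSign (insert y (α.erase x)) γ * kappaSign A γᶜ * M (insert y (α.erase x)) γᶜ)
            = (jwSign x γ * jwSign y γ * pairSign (insert y (α.erase x)) γ) *
                (kappaSign A γᶜ * (jwSign x α * jwSign y (α.erase x) * M (insert y (α.erase x)) γᶜ)) := by ring
          _ = _ := by rw [hθ]; ring
      · rw [if_neg hc, if_neg hc, mul_zero]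
    · rw [if_neg hadj, if_neg hadj, mul_zero]
  -- (L2) down-spin hopping, matched with the hole-hopping matrix after reindexing `x ↔ y`
  have hL2 : (∑ x : Λ, ∑ y : Λ, if G.Adj x y then
        ((creation (orb x 1) * annihilation (orb y 1)) *ᵥ ψ) (pairSet α γ) else 0) =
      pairSign α γ * kappaSign A β * ∑ x : Λ, ∑ y : Λ, if G.Adj x y then
        (if x ∈ β ∧ y ∉ β.erase x then jwSign x β * jwSign y (β.erase x) * M α (insert y (β.erase x)) else 0)
        else 0 := by
    conv_rhs => rw [Finset.sum_comm]
    rw [Finset.mul_sum]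
    refine Finset.sum_congr rfl fun x _ => ?_
    rw [Finset.mul_sum]
    refine Finset.sum_congr rfl fun y _ => ?_
    by_cases hadj : G.Adj x y
    · have hxy : x ≠ y := G.ne_of_adj hadj
      rw [if_pos hadj, if_pos hadj.symm, hψ, hopDn_mulVec_pairSet]
      by_cases hc : x ∈ γ ∧ y ∉ γ.erase x
      · have hyγ : y ∉ γ := fun h => hc.2 (mem_erase.2 ⟨hxy.symm, h⟩)
        have hc' : y ∈ β ∧ x ∉ β.erase y := by
          rw [hβ, mem_compl, mem_erase, mem_compl]
          exact ⟨hyγ, fun h => h.2 hc.1⟩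
        rw [if_pos hc, if_pos hc', toFock_pairSet, hβ]
        have hK := pairSignKappa_move_right' A hxy (hA x y hadj) hc.1 hyγ α
        calc jwSign x α * memSign α x * (jwSign y α * memSign α y) * (jwSign x γ * jwSign y (γ.erase x)) *
              (pairSign α (insert y (γ.erase x)) * kappaSign A (insert y (γ.erase x))ᶜ *
                M α (insert y (γ.erase x))ᶜ)
            = (jwSign x α * memSign α x * (jwSign y α * memSign α y) * (jwSign x γ * jwSign y (γ.erase x)) *
                (pairSign α (insert y (γ.erase x)) * kappaSign A (insert y (γ.erase x))ᶜ)) *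
                M α (insert y (γ.erase x))ᶜ := by ring
          _ = pairSign α γ * kappaSign A γᶜ * (jwSign y γᶜ * jwSign x (γᶜ.erase y)) *
                M α (insert y (γ.erase x))ᶜ := by rw [hK]
          _ = _ := by
            have hc2 : (insert y (γ.erase x))ᶜ = insert x (γᶜ.erase y) := by
              ext z
              simp only [mem_compl, mem_insert, mem_erase, not_or, not_and]
              constructor
              · rintro ⟨hzy, hz⟩
                by_cases hzx : z = x
                · exact Or.inl hzx
                · exact Or.inr ⟨hzy, fun hzγ => hzx (by_contra fun hne => (hz hne) hzγ |>.elim)⟩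
              · rintro (rfl | ⟨hzy, hz⟩)
                · exact ⟨hxy, fun h _ => h rfl⟩
                · exact ⟨hzy, fun _ hzγ => hz hzγ⟩
            rw [hc2]; ring
      · have hc' : ¬ (y ∈ β ∧ x ∉ β.erase y) := by
          rintro ⟨hyβ, hxβ⟩
          rw [hβ, mem_compl] at hyβ
          rw [hβ, mem_erase, mem_compl, not_and, not_not] at hxβ
          exact hc ⟨hxβ hxy, fun h => hyβ (mem_of_mem_erase h)⟩
        rw [if_neg hc, if_neg hc', mul_zero]
    · rw [if_neg hadj, if_neg (fun h => hadj h.symm), mul_zero]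
  -- (L3) interaction
  have hL3 : (∑ x : Λ, ((numberOp x 0 * numberOp x 1) *ᵥ ψ) (pairSet α γ)) =
      ((α ∩ γ).card : ℂ) * (pairSign α γ * kappaSign A β * M α β) := by
    simp only [numberOp_mul_numberOp_mulVec, orb_zero_mem_pairSet, orb_one_mem_pairSet]
    rw [← Finset.sum_filter, Finset.sum_const, nsmul_eq_mul, hψ, toFock_pairSet]
    have hf : (univ.filter fun x : Λ => x ∈ α ∧ x ∈ γ) = α ∩ γ := by ext x; simp
    rw [hf]
  -- the right-hand side
  have hR1 : (hoppingMatrix G t * M) α β = -(t : ℂ) * ∑ x : Λ, ∑ y : Λ, if G.Adj x y then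
      (if x ∈ α ∧ y ∉ α.erase x then jwSign x α * jwSign y (α.erase x) * M (insert y (α.erase x)) β else 0)
      else 0 := by
    rw [← hoppingMatrix_mulVec G t (fun c => M c β) α]; rfl
  have hR2 : (M * hoppingMatrix G t) α β = -(t : ℂ) * ∑ x : Λ, ∑ y : Λ, if G.Adj x y then
      (if x ∈ β ∧ y ∉ β.erase x then jwSign x β * jwSign y (β.erase x) * M α (insert y (β.erase x)) else 0)
      else 0 := by
    rw [← hoppingMatrix_mulVec G t (M α) β, Matrix.mul_apply, mulVec, dotProduct]
    refine Finset.sum_congr rfl fun c _ => ?_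
    rw [mul_comm]
    congr 1
    exact hoppingMatrix_transpose_apply t β c
  have hR3 : (∑ x : Λ, Literature.MathematicalPhysics.QuantumLattice.numberAt x * M * Literature.MathematicalPhysics.QuantumLattice.numberAt x) α β =
      ((α ∩ β).card : ℂ) * M α β := by
    rw [Matrix.sum_apply]
    simp only [Literature.MathematicalPhysics.QuantumLattice.numberAt_eq_diagonal, mul_diagonal, diagonal_mul]
    have : ∀ x : Λ, (if x ∈ α then (1 : ℂ) else 0) * M α β * (if x ∈ β then 1 else 0) =
        if x ∈ α ∧ x ∈ β then M α β else 0 := by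
      intro x
      by_cases h1 : x ∈ α <;> by_cases h2 : x ∈ β <;> simp [h1, h2]
    simp only [this]
    rw [← Finset.sum_filter, Finset.sum_const, nsmul_eq_mul]
    have hf : (univ.filter fun x : Λ => x ∈ α ∧ x ∈ β) = α ∩ β := by ext x; simp
    rw [hf]
  have hR4 : ((Literature.MathematicalPhysics.QuantumLattice.totalNumberOp : Matrix (Finset Λ) (Finset Λ) ℂ) * M) α β = (α.card : ℂ) * M α β := by
    rw [Literature.MathematicalPhysics.QuantumLattice.totalNumberOp_eq_diagonal, diagonal_mul]
  have hcard : ((α ∩ γ).card : ℂ) = α.card - (α ∩ β).card := by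
    have h := Finset.card_sdiff_add_card_inter α β
    have h2 : α \ β = α ∩ γ := by
      ext z; rw [mem_sdiff, mem_inter, hβ, mem_compl, not_not]
    rw [h2] at h
    rw [eq_sub_iff_add_eq]
    exact_mod_cast h
  rw [hL, hL1, hL2, hL3, toFock_pairSet, liebOperator, Literature.MathematicalPhysics.QuantumLattice.liebOp, Matrix.add_apply, Matrix.add_apply,
    Matrix.add_apply, Matrix.smul_apply, Matrix.smul_apply, smul_eq_mul, smul_eq_mul, hR1, hR2, hR3, hR4,
    Complex.ofReal_neg]
  linear_combination ((U : ℂ) * pairSign α γ * kappaSign A β * M α β) * hcard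

end Intertwiner

end Literature.MathematicalPhysics.QuantumLattice.LiebTwo
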